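import Mathlib.NumberTheory.Chebyshev
import Mathlib.Analysis.SpecialFunctions.Stirling
import Mathlib.Analysis.Complex.ExponentialBounds
import Literature.NumberTheory.LFunctions.KadiriNumericsBase
import HarnessLib

/-!
# Chebyshev's explicit bounds for `ψ` and `θ` (the `1, 2, 3, 5, 30` argument)

Topic `Literature/NumberTheory/LFunctions`. Chebyshev (1852) compared `T(x) = log ⌊x⌋!` with the
alternating combination `U(x) = T(x) − T(x/2) − T(x/3) − T(x/5) + T(x/30)` and obtained
`A x − O(log x) ≤ ψ(x) ≤ (6A/5) x + O(log² x)`, `A = log(2^{1/2} 3^{1/3} 5^{1/5} / 30^{1/30}) = 0.92129…`,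
`6A/5 = 1.10555…`. Everything here is PROVED, over integer arguments (which is all the tree needs):

* `log_factorial_eq_sum_psi` — Legendre/Chebyshev: `log n! = ∑_{m ≤ n} ψ(⌊n/m⌋)`;
* `U_eq_sum` — `U(n) = ∑_{m ≤ n} e(m) ψ(⌊n/m⌋)` with the `30`-periodic `e(m) ∈ {0, ±1}` whose partial
  sums lie in `{0, 1}` (`ECum_mem`), whence `ψ(n) − ψ(⌊n/6⌋) ≤ U(n) ≤ ψ(n)` (`U_le_psi`, `psi_sub_le_U`);
* Stirling (Mathlib) gives `|U(n) − A n| ≤ 5 log n` (`abs_U_sub_le`), and then the explicit bounds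
  `psi_ge_chebyshev : A n − 5 log n ≤ ψ(n)` (`n ≥ 30`) and
  `psi_le_chebyshev : ψ(n) ≤ (6A/5) n + 3 log² n + 80`;
* for the consumer (`TuranPartialSums`, envelope hypothesis at `X = 10⁶`):
  `theta_bounds_1e6 : 10⁶ ≤ n → 0.9166 n ≤ θ(n) ≤ 1.107 n`.

## References

* [Chebyshev1852] P. L. Tchebichef, *Mémoire sur les nombres premiers*, J. Math. Pures Appl. 17
  (1852), 366–390, §§3–5.
* [Diamond1982] H. G. Diamond, *Elementary methods in the study of the distribution of prime
  numbers*, Bull. AMS 7 (1982), 553–589, §3 (the `T(x) − T(x/2) − T(x/3) − T(x/5) + T(x/30)` argument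
  and the constants `A`, `6A/5`).
-/

noncomputable section

open Finset Real ArithmeticFunction
open scoped Chebyshev

namespace Literature.NumberTheory.LFunctions.ChebyshevExplicit

/-! ### `ψ` at integers -/

/-- `ψ(n) = ∑_{k ∈ (0, n]} Λ(k)` at a natural number. [folklore] -/
theorem psi_natCast (n : ℕ) : ψ (n : ℝ) = ∑ k ∈ Ioc 0 n, vonMangoldt k := by
  rw [Chebyshev.psi, Nat.floor_natCast]

/-- `ψ(n+1) = ψ(n) + Λ(n+1)`. [folklore] -/
theorem psi_succ (n : ℕ) : ψ ((n + 1 : ℕ) : ℝ) = ψ (n : ℝ) + vonMangoldt (n + 1) := by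
  rw [psi_natCast, psi_natCast, Finset.sum_Ioc_succ_top (Nat.zero_le n)]

/-- `ψ(0) = 0`. [folklore] -/
theorem psi_cast_zero : ψ ((0 : ℕ) : ℝ) = 0 := by
  rw [psi_natCast]; simp

/-- `ψ` is monotone along the naturals. [folklore] -/
theorem psi_mono_nat {a b : ℕ} (h : a ≤ b) : ψ (a : ℝ) ≤ ψ (b : ℝ) :=
  Chebyshev.psi_mono (by exact_mod_cast h)

/-! ### Legendre–Chebyshev: `log n! = ∑_{m ≤ n} ψ(⌊n/m⌋)` -/

/-- `log n! = ∑_{k ≤ n} log k`. [folklore] -/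
theorem log_factorial_eq_sum_log (n : ℕ) : Real.log (n.factorial) = ∑ k ∈ Icc 1 n, Real.log k := by
  induction n with
  | zero => simp
  | succ n ih =>
    rw [Nat.factorial_succ, Nat.cast_mul, Real.log_mul (by positivity) (by positivity), ih,
      Finset.sum_Icc_succ_top (by omega)]
    push_cast; ring

/-- The step of the identity: `∑_{m ≤ n} (ψ(⌊(n+1)/m⌋) − ψ(⌊n/m⌋)) = log(n+1) − Λ? `; precisely
`∑_{m ∈ [1,n+1]} ψ(⌊(n+1)/m⌋) = ∑_{m ∈ [1,n]} ψ(⌊n/m⌋) + log(n+1)`. [folklore] -/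
theorem sum_psi_div_succ (n : ℕ) :
    ∑ m ∈ Icc 1 (n + 1), ψ (((n + 1) / m : ℕ) : ℝ) = ∑ m ∈ Icc 1 n, ψ ((n / m : ℕ) : ℝ) + Real.log (n + 1) := by
  rw [Finset.sum_Icc_succ_top (by omega), Nat.div_self (by omega)]
  have h1 : ψ ((1 : ℕ) : ℝ) = 0 := by
    rw [psi_natCast, show Ioc 0 1 = {1} by rfl, Finset.sum_singleton, vonMangoldt_apply_one]
  rw [h1, add_zero]
  -- termwise: `(n+1)/m = n/m + [m ∣ n+1]`
  have hterm : ∀ m ∈ Icc 1 n, ψ (((n + 1) / m : ℕ) : ℝ) =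
      ψ ((n / m : ℕ) : ℝ) + if m ∣ n + 1 then vonMangoldt ((n + 1) / m) else 0 := by
    intro m hm
    rw [Finset.mem_Icc] at hm
    rw [Nat.succ_div]
    split_ifs with hd
    · rw [psi_succ]
    · simp
  rw [Finset.sum_congr rfl hterm, Finset.sum_add_distrib, ← Finset.sum_filter]
  congr 1
  -- `∑_{m ≤ n, m ∣ n+1} Λ((n+1)/m) = ∑_{d ∣ n+1} Λ(d) − Λ(1) = log(n+1)`
  have hset : (Icc 1 n).filter (fun m ↦ m ∣ n + 1) = (n + 1).divisors.erase (n + 1) := by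
    ext m
    simp only [Finset.mem_filter, Finset.mem_Icc, Finset.mem_erase, Nat.mem_divisors]
    constructor
    · rintro ⟨⟨h1, h2⟩, hd⟩; exact ⟨by omega, hd, by omega⟩
    · rintro ⟨hne, hd, -⟩
      have := Nat.le_of_dvd (by omega) hd
      have h1 : 1 ≤ m := Nat.pos_of_dvd_of_pos hd (by omega)
      exact ⟨⟨h1, by omega⟩, hd⟩
  rw [hset, Finset.sum_erase_eq_sub (Nat.mem_divisors_self _ (by omega)), Nat.div_self (by omega),
    vonMangoldt_apply_one, sub_zero, Nat.sum_div_divisors (n + 1) (fun d ↦ (vonMangoldt d : ℝ)), vonMangoldt_sum]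
  push_cast; ring

/-- **Legendre–Chebyshev.** `log n! = ∑_{m=1}^{n} ψ(⌊n/m⌋)`. [cite: Diamond1982, §3] -/
theorem log_factorial_eq_sum_psi (n : ℕ) :
    Real.log (n.factorial) = ∑ m ∈ Icc 1 n, ψ ((n / m : ℕ) : ℝ) := by
  induction n with
  | zero => simp
  | succ n ih =>
    rw [sum_psi_div_succ, ← ih, Nat.factorial_succ, Nat.cast_mul, Real.log_mul (by positivity) (by positivity)]
    push_cast; ring

/-! ### The combination `U` and the coefficients `e` -/

/-- `T(q) = log q!`. [folklore] -/
def T (q : ℕ) : ℝ := Real.log (q.factorial)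

/-- `U(n) = T(n) − T(⌊n/2⌋) − T(⌊n/3⌋) − T(⌊n/5⌋) + T(⌊n/30⌋)`. [cite: Diamond1982, §3] -/
def U (n : ℕ) : ℝ := T n - T (n / 2) - T (n / 3) - T (n / 5) + T (n / 30)

/-- The indicator of `k ∣ m` as an integer. [folklore] -/
def dvdInd (k m : ℕ) : ℤ := if k ∣ m then 1 else 0

/-- `e(m) = 1 − [2∣m] − [3∣m] − [5∣m] + [30∣m]`. [cite: Diamond1982, §3] -/
def eCoef (m : ℕ) : ℤ := dvdInd 1 m - dvdInd 2 m - dvdInd 3 m - dvdInd 5 m + dvdInd 30 m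

/-- `T(⌊n/k⌋) = ∑_{m ≤ n} [k ∣ m] ψ(⌊n/m⌋)` (`1 ≤ k`). [folklore] -/
theorem T_div_eq_sum (n k : ℕ) (hk : 1 ≤ k) :
    T (n / k) = ∑ m ∈ Icc 1 n, (dvdInd k m : ℝ) * ψ ((n / m : ℕ) : ℝ) := by
  unfold T
  rw [log_factorial_eq_sum_psi]
  -- reindex `m ↦ k m`
  have hinj : Set.InjOn (fun m ↦ k * m) (Icc 1 (n / k) : Finset ℕ) := fun a _ b _ h ↦
    Nat.eq_of_mul_eq_mul_left (by omega) h
  have himage : (Icc 1 (n / k)).image (fun m ↦ k * m) = (Icc 1 n).filter (fun m ↦ k ∣ m) := by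
    ext m
    simp only [Finset.mem_image, Finset.mem_Icc, Finset.mem_filter]
    constructor
    · rintro ⟨a, ⟨ha1, ha2⟩, rfl⟩
      refine ⟨⟨by nlinarith, ?_⟩, dvd_mul_right _ _⟩
      exact (Nat.le_div_iff_mul_le (by omega)).1 ha2 |>.trans_eq' (Nat.mul_comm _ _) |> fun h ↦ by
        rw [Nat.mul_comm]; exact (Nat.le_div_iff_mul_le (by omega)).1 ha2
    · rintro ⟨⟨h1, h2⟩, ⟨a, rfl⟩⟩
      refine ⟨a, ⟨?_, ?_⟩, rfl⟩
      · rcases Nat.eq_zero_or_pos a with h0 | h0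
        · subst h0; simp at h1
        · exact h0
      · exact (Nat.le_div_iff_mul_le (by omega)).2 (by rw [Nat.mul_comm]; exact h2)
  calc ∑ m ∈ Icc 1 (n / k), ψ (((n / k) / m : ℕ) : ℝ)
      = ∑ m ∈ Icc 1 (n / k), ψ ((n / (k * m) : ℕ) : ℝ) := by
        refine Finset.sum_congr rfl fun m _ ↦ ?_; rw [Nat.div_div_eq_div_mul]
    _ = ∑ m' ∈ (Icc 1 (n / k)).image (fun m ↦ k * m), ψ ((n / m' : ℕ) : ℝ) := by
        rw [Finset.sum_image hinj]
    _ = ∑ m ∈ (Icc 1 n).filter (fun m ↦ k ∣ m), ψ ((n / m : ℕ) : ℝ) := by rw [himage]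
    _ = ∑ m ∈ Icc 1 n, (dvdInd k m : ℝ) * ψ ((n / m : ℕ) : ℝ) := by
        rw [Finset.sum_filter]
        refine Finset.sum_congr rfl fun m _ ↦ ?_
        unfold dvdInd
        split_ifs <;> simp

/-- **`U` as a `ψ`-sum.** `U(n) = ∑_{m ≤ n} e(m) ψ(⌊n/m⌋)`. [cite: Diamond1982, §3] -/
theorem U_eq_sum (n : ℕ) : U n = ∑ m ∈ Icc 1 n, (eCoef m : ℝ) * ψ ((n / m : ℕ) : ℝ) := by
  unfold U
  rw [show T n = T (n / 1) by rw [Nat.div_one], T_div_eq_sum n 1 le_rfl, T_div_eq_sum n 2 (by norm_num),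
    T_div_eq_sum n 3 (by norm_num), T_div_eq_sum n 5 (by norm_num), T_div_eq_sum n 30 (by norm_num)]
  rw [← Finset.sum_sub_distrib, ← Finset.sum_sub_distrib, ← Finset.sum_sub_distrib, ← Finset.sum_add_distrib]
  refine Finset.sum_congr rfl fun m _ ↦ ?_
  unfold eCoef
  push_cast
  ring

/-! ### The partial sums of `e` lie in `{0, 1}` -/

/-- `E(M) = ∑_{m ≤ M} e(m)`. [folklore] -/
def ECum (M : ℕ) : ℤ := ∑ m ∈ Icc 1 M, eCoef m

/-- `e` is `30`-periodic. [folklore] -/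
theorem eCoef_add_thirty (m : ℕ) : eCoef (m + 30) = eCoef m := by
  unfold eCoef dvdInd
  have h2 : 2 ∣ m + 30 ↔ 2 ∣ m := by omega
  have h3 : 3 ∣ m + 30 ↔ 3 ∣ m := by omega
  have h5 : 5 ∣ m + 30 ↔ 5 ∣ m := by omega
  have h30 : 30 ∣ m + 30 ↔ 30 ∣ m := by omega
  simp only [h2, h3, h5, h30, one_dvd]

/-- The sum of `e` over any `30` consecutive integers vanishes. [folklore] -/
theorem sum_eCoef_period (M : ℕ) : ∑ m ∈ Ioc M (M + 30), eCoef m = 0 := by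
  induction M with
  | zero => decide
  | succ M ih =>
    have h1 : ∑ m ∈ Ioc (M + 1) (M + 1 + 30), eCoef m = ∑ m ∈ Ioc (M + 1) (M + 30), eCoef m + eCoef (M + 31) := by
      rw [show M + 1 + 30 = (M + 30) + 1 by ring, Finset.sum_Ioc_succ_top (by omega)]
    have h2 : ∑ m ∈ Ioc M (M + 30), eCoef m = eCoef (M + 1) + ∑ m ∈ Ioc (M + 1) (M + 30), eCoef m := by
      rw [← Finset.sum_Ioc_consecutive (f := eCoef) (by omega : M ≤ M + 1) (by omega : M + 1 ≤ M + 30)]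
      congr 1
      rw [show Ioc M (M + 1) = {M + 1} by ext m; simp only [Finset.mem_Ioc, Finset.mem_singleton]; omega]
      simp
    rw [h1, show M + 31 = (M + 1) + 30 by ring, eCoef_add_thirty]
    linarith

/-- `E(M + 30) = E(M)`. [folklore] -/
theorem ECum_add_thirty (M : ℕ) : ECum (M + 30) = ECum M := by
  unfold ECum
  have hsplit : Icc 1 (M + 30) = Icc 1 M ∪ Ioc M (M + 30) := by
    ext m; simp only [Finset.mem_Icc, Finset.mem_union, Finset.mem_Ioc]; omega
  rw [hsplit, Finset.sum_union (by
    rw [Finset.disjoint_left]; intro m h1 h2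
    rw [Finset.mem_Icc] at h1; rw [Finset.mem_Ioc] at h2; omega), sum_eCoef_period, add_zero]

/-- The partial sums on the first period. [folklore] -/
theorem ECum_mem_small : ∀ M, M < 30 → ECum M = 0 ∨ ECum M = 1 := by decide

/-- **`E(M) ∈ {0, 1}`.** [cite: Diamond1982, §3] -/
theorem ECum_mem (M : ℕ) : ECum M = 0 ∨ ECum M = 1 := by
  induction M using Nat.strong_induction_on with
  | _ M ih =>
    rcases lt_or_ge M 30 with h | h
    · exact ECum_mem_small M h
    · obtain ⟨M', rfl⟩ : ∃ M', M = M' + 30 := ⟨M - 30, by omega⟩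
      rw [ECum_add_thirty]
      exact ih M' (by omega)

/-- `E(M) = 1` for `1 ≤ M ≤ 5`. [folklore] -/
theorem ECum_eq_one {M : ℕ} (h1 : 1 ≤ M) (h5 : M ≤ 5) : ECum M = 1 := by
  interval_cases M <;> decide

/-- `E(0) = 0`. [folklore] -/
theorem ECum_zero : ECum 0 = 0 := by decide

/-- `E(M+1) = E(M) + e(M+1)`. [folklore] -/
theorem ECum_succ (M : ℕ) : ECum (M + 1) = ECum M + eCoef (M + 1) := by
  unfold ECum; rw [Finset.sum_Icc_succ_top (by omega)]

/-! ### `ψ(n) − ψ(⌊n/6⌋) ≤ U(n) ≤ ψ(n)` -/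

/-- Summation by parts on `(0, n]`. [folklore] -/
theorem abel_Ioc0 (C w : ℕ → ℝ) {n : ℕ} (hn : 0 < n) :
    ∑ m ∈ Ioc 0 n, (C m - C (m - 1)) * w m =
      C n * w n - C 0 * w 1 - ∑ m ∈ Ico 1 n, C m * (w (m + 1) - w m) := by
  induction n, hn using Nat.le_induction with
  | base => simp; ring
  | succ k hk ih =>
    rw [Finset.sum_Ioc_succ_top (by omega), ih, Finset.sum_Ico_succ_top (by omega), Nat.add_sub_cancel]
    ring

/-- `U(n) = E(n)·ψ(⌊n/n⌋)·… `: the Abel form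
`U(n) = E(n) ψ(1) + ∑_{1 ≤ m < n} E(m) (ψ(⌊n/m⌋) − ψ(⌊n/(m+1)⌋))`. [folklore] -/
theorem U_abel {n : ℕ} (hn : 0 < n) :
    U n = (ECum n : ℝ) * ψ ((n / n : ℕ) : ℝ) +
      ∑ m ∈ Ico 1 n, (ECum m : ℝ) * (ψ ((n / m : ℕ) : ℝ) - ψ ((n / (m + 1) : ℕ) : ℝ)) := by
  rw [U_eq_sum]
  have h := abel_Ioc0 (fun m ↦ (ECum m : ℝ)) (fun m ↦ ψ ((n / m : ℕ) : ℝ)) hn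
  simp only [ECum_zero, Int.cast_zero, zero_mul, sub_zero] at h
  have hIoc : Icc 1 n = Ioc 0 n := by ext m; simp only [Finset.mem_Icc, Finset.mem_Ioc]; omega
  rw [hIoc]
  have hcoef : ∀ m ∈ Ioc 0 n, (eCoef m : ℝ) * ψ ((n / m : ℕ) : ℝ) =
      ((ECum m : ℝ) - ECum (m - 1)) * ψ ((n / m : ℕ) : ℝ) := by
    intro m hm
    rw [Finset.mem_Ioc] at hm
    obtain ⟨k, rfl⟩ : ∃ k, m = k + 1 := ⟨m - 1, by omega⟩
    rw [Nat.add_sub_cancel, ECum_succ]; push_cast; ring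
  rw [Finset.sum_congr rfl hcoef, h]
  have : ∑ m ∈ Ico 1 n, (ECum m : ℝ) * (ψ ((n / (m + 1) : ℕ) : ℝ) - ψ ((n / m : ℕ) : ℝ)) =
      -∑ m ∈ Ico 1 n, (ECum m : ℝ) * (ψ ((n / m : ℕ) : ℝ) - ψ ((n / (m + 1) : ℕ) : ℝ)) := by
    rw [← Finset.sum_neg_distrib]; refine Finset.sum_congr rfl fun m _ ↦ by ring
  rw [this]; ring

/-- `0 ≤ E(m) ≤ 1` as reals. [folklore] -/
theorem ECum_nonneg_le (m : ℕ) : (0 : ℝ) ≤ ECum m ∧ (ECum m : ℝ) ≤ 1 := by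
  rcases ECum_mem m with h | h <;> simp [h]

/-- The steps `ψ(⌊n/m⌋) − ψ(⌊n/(m+1)⌋)` are nonnegative. [folklore] -/
theorem psi_div_step_nonneg (n : ℕ) {m : ℕ} (hm : 1 ≤ m) :
    0 ≤ ψ ((n / m : ℕ) : ℝ) - ψ ((n / (m + 1) : ℕ) : ℝ) :=
  sub_nonneg.2 (psi_mono_nat (Nat.div_le_div_left (Nat.le_succ m) hm))

/-- **Upper bound** `U(n) ≤ ψ(n)`. [cite: Diamond1982, §3] -/
theorem U_le_psi {n : ℕ} (hn : 0 < n) : U n ≤ ψ (n : ℝ) := by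
  rw [U_abel hn]
  have h1 : (ECum n : ℝ) * ψ ((n / n : ℕ) : ℝ) ≤ ψ ((n / n : ℕ) : ℝ) := by
    have := ECum_nonneg_le n
    have h0 := Chebyshev.psi_nonneg (((n / n : ℕ) : ℝ))
    nlinarith
  have h2 : ∑ m ∈ Ico 1 n, (ECum m : ℝ) * (ψ ((n / m : ℕ) : ℝ) - ψ ((n / (m + 1) : ℕ) : ℝ)) ≤
      ∑ m ∈ Ico 1 n, (ψ ((n / m : ℕ) : ℝ) - ψ ((n / (m + 1) : ℕ) : ℝ)) := by
    refine Finset.sum_le_sum fun m hm ↦ ?_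
    rw [Finset.mem_Ico] at hm
    have := ECum_nonneg_le m
    have h0 := psi_div_step_nonneg n hm.1
    nlinarith
  -- telescope
  have htel : ∀ k, 1 ≤ k → ∑ m ∈ Ico 1 k, (ψ ((n / m : ℕ) : ℝ) - ψ ((n / (m + 1) : ℕ) : ℝ)) =
      ψ ((n / 1 : ℕ) : ℝ) - ψ ((n / k : ℕ) : ℝ) := by
    intro k hk
    induction k, hk using Nat.le_induction with
    | base => simp
    | succ j hj ih => rw [Finset.sum_Ico_succ_top hj, ih]; ring
  rw [htel n hn] at h2
  rw [Nat.div_one] at h2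
  linarith

/-- **Lower bound** `ψ(n) − ψ(⌊n/6⌋) ≤ U(n)` (`n ≥ 6`). [cite: Diamond1982, §3] -/
theorem psi_sub_le_U {n : ℕ} (hn : 6 ≤ n) : ψ (n : ℝ) - ψ ((n / 6 : ℕ) : ℝ) ≤ U n := by
  rw [U_abel (by omega)]
  have h1 : 0 ≤ (ECum n : ℝ) * ψ ((n / n : ℕ) : ℝ) :=
    mul_nonneg (ECum_nonneg_le n).1 (Chebyshev.psi_nonneg _)
  -- keep the terms `m = 1, …, 5` (where `E(m) = 1`), drop the others
  have hsplit : Ico 1 n = Ico 1 6 ∪ Ico 6 n := by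
    rw [Finset.Ico_union_Ico_eq_Ico (by norm_num) hn]
  rw [hsplit, Finset.sum_union (Finset.Ico_disjoint_Ico_consecutive 1 6 n)]
  have h2 : ∑ m ∈ Ico 1 6, (ECum m : ℝ) * (ψ ((n / m : ℕ) : ℝ) - ψ ((n / (m + 1) : ℕ) : ℝ)) =
      ψ (n : ℝ) - ψ ((n / 6 : ℕ) : ℝ) := by
    have hE : ∀ m ∈ Ico 1 6, (ECum m : ℝ) = 1 := fun m hm ↦ by
      rw [Finset.mem_Ico] at hm
      rw [ECum_eq_one hm.1 (by omega)]; simp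
    rw [Finset.sum_congr rfl fun m hm ↦ by rw [hE m hm, one_mul]]
    simp [Finset.sum_Ico_succ_top]
    ring
  have h3 : 0 ≤ ∑ m ∈ Ico 6 n, (ECum m : ℝ) * (ψ ((n / m : ℕ) : ℝ) - ψ ((n / (m + 1) : ℕ) : ℝ)) :=
    Finset.sum_nonneg fun m hm ↦ mul_nonneg (ECum_nonneg_le m).1
      (psi_div_step_nonneg n (by rw [Finset.mem_Ico] at hm; omega))
  linarith

/-! ### Numerical logarithms (`log 2` from Mathlib; `log 3`, `log 5` from the tree) -/

/-- `log 2 ∈ [0.69314718, 0.693147181]` (Mathlib's nine-digit bounds). [folklore] -/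
theorem log_two_bounds : (0.69314718 : ℝ) ≤ Real.log 2 ∧ Real.log 2 ≤ 0.693147181 :=
  ⟨by linarith [Real.log_two_gt_d9], by linarith [Real.log_two_lt_d9]⟩

/-- Chebyshev's constant `A = (14 log 2 + 9 log 3 + 5 log 5)/30 = log(2^{1/2}3^{1/3}5^{1/5}30^{-1/30})`.
[cite: Chebyshev1852, §5] -/
def A : ℝ := (14 * Real.log 2 + 9 * Real.log 3 + 5 * Real.log 5) / 30

/-- `A ∈ [0.921292, 0.921293]`. [folklore] -/
theorem A_bounds : (0.921292 : ℝ) ≤ A ∧ A ≤ 0.921293 := by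
  unfold A
  have h2 := log_two_bounds; have h3 := KadiriNumerics.log_3_bounds; have h5 := KadiriNumerics.log_5_bounds
  constructor <;> linarith [h2.1, h2.2, h3.1, h3.2, h5.1, h5.2]

/-! ### Stirling: `T(q) = q log q − q + ½ log q + O(1)` -/

/-- **Two-sided Stirling** for `log q!`, `q ≥ 1`:
`q log q − q + ½ log q + ½ log(2π) ≤ log q! ≤ q log q − q + ½ log q + 1`. [folklore] -/
theorem T_bounds {q : ℕ} (hq : 1 ≤ q) :
    (q : ℝ) * Real.log q - q + Real.log q / 2 + Real.log (2 * Real.pi) / 2 ≤ T q ∧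
      T q ≤ (q : ℝ) * Real.log q - q + Real.log q / 2 + 1 := by
  constructor
  · exact Stirling.le_log_factorial_stirling (by omega)
  · -- `stirlingSeq q ≤ stirlingSeq 1 = e/√2`
    obtain ⟨k, rfl⟩ : ∃ k, q = k + 1 := ⟨q - 1, by omega⟩
    have hanti : Stirling.stirlingSeq (k + 1) ≤ Stirling.stirlingSeq (0 + 1) :=
      Stirling.stirlingSeq'_antitone (Nat.zero_le k)
    rw [zero_add, Stirling.stirlingSeq_one] at hanti
    have hpos := Stirling.stirlingSeq'_pos k
    have hlog := Real.log_le_log hpos hanti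
    have hr : Real.log (Real.exp 1 / √2) = 1 - Real.log 2 / 2 := by
      rw [Real.log_div (by positivity) (by positivity), Real.log_exp, Real.log_sqrt (by norm_num)]
    rw [hr, Stirling.log_stirlingSeq_formula] at hlog
    have hk0 : (0 : ℝ) < (k + 1 : ℕ) := by positivity
    rw [Real.log_mul (by norm_num) hk0.ne', Real.log_div hk0.ne' (by positivity), Real.log_exp] at hlog
    unfold T
    linarith

/-! ### `|U(n) − A n| ≤ 5 log n` -/

/-- `g(t) = t log t − t`. [folklore] -/
def g (t : ℝ) : ℝ := t * Real.log t - t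

/-- For `1 ≤ x ≤ y`: `0 ≤ g y − g x ≤ (y − x) log y`. [folklore] -/
theorem g_sub_bounds {x y : ℝ} (hx : 1 ≤ x) (hxy : x ≤ y) :
    0 ≤ g y - g x ∧ g y - g x ≤ (y - x) * Real.log y := by
  have hx0 : 0 < x := by linarith
  have hy0 : 0 < y := by linarith
  unfold g
  -- `log y − log x ∈ [(y−x)/y, (y−x)/x]`
  have hl1 : Real.log y - Real.log x ≤ (y - x) / x := by
    rw [← Real.log_div hy0.ne' hx0.ne']
    have := Real.log_le_sub_one_of_pos (show 0 < y / x by positivity)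
    rw [div_sub_one hx0.ne'] at this
    exact this
  have hl2 : (y - x) / y ≤ Real.log y - Real.log x := by
    rw [← Real.log_div hy0.ne' hx0.ne']
    have := Real.one_sub_inv_le_log_of_pos (show 0 < y / x by positivity)
    rw [inv_div] at this
    have heq : (y - x) / y = 1 - x / y := by field_simp
    linarith
  have hlogy : Real.log y ≥ 1 - 1 / y := by
    have := Real.one_sub_inv_le_log_of_pos hy0
    rw [one_div]; exact this
  have hlogx0 : 0 ≤ Real.log x := Real.log_nonneg hx
  constructor
  · -- `y log y − x log x − (y − x) = (y−x) log y + x (log y − log x) − (y − x)`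
    have hxl : x * (Real.log y - Real.log x) ≥ x * ((y - x) / y) := mul_le_mul_of_nonneg_left hl2 hx0.le
    have : x * ((y - x) / y) = (y - x) * (x / y) := by ring
    have hxy1 : x / y ≤ 1 := (div_le_one hy0).2 hxy
    nlinarith [mul_nonneg (sub_nonneg.2 hxy) (show 0 ≤ Real.log y - (1 - 1 / y) by linarith),
      show (y - x) * (1 - 1 / y) + (y - x) * (x / y) - (y - x) = (y - x) * ((x - 1) / y) by ring,
      div_nonneg (by linarith : 0 ≤ x - 1) hy0.le]
  · have hxl : x * (Real.log y - Real.log x) ≤ x * ((y - x) / x) := mul_le_mul_of_nonneg_left hl1 hx0.le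
    rw [mul_div_cancel₀ _ hx0.ne'] at hxl
    nlinarith

/-- `∑ c_k g(n/k) = A n` for the weights `k ∈ {1,2,3,5,30}`, `c = (1,−1,−1,−1,1)`. [cite: Diamond1982, §3] -/
theorem main_term (n : ℝ) (hn : 0 < n) :
    g n - g (n / 2) - g (n / 3) - g (n / 5) + g (n / 30) = A * n := by
  unfold g A
  have h30 : Real.log 30 = Real.log 2 + Real.log 3 + Real.log 5 := by
    rw [show (30 : ℝ) = 2 * 3 * 5 by norm_num, Real.log_mul (by norm_num) (by norm_num),
      Real.log_mul (by norm_num) (by norm_num)]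
  rw [Real.log_div hn.ne' (by norm_num), Real.log_div hn.ne' (by norm_num),
    Real.log_div hn.ne' (by norm_num), Real.log_div hn.ne' (by norm_num), h30]
  ring

/-- The remainder of `T` at `⌊n/k⌋` against `g(n/k)`: `|T(⌊n/k⌋) − g(n/k)| ≤ log n` for
`1 ≤ k ≤ n`, `8 ≤ n`. [folklore] -/
theorem abs_T_sub_g_le {n k : ℕ} (hk : 1 ≤ k) (hkn : k ≤ n) (hn : 8 ≤ n) :
    |T (n / k) - g ((n : ℝ) / k)| ≤ Real.log n := by
  set q := n / k with hq
  have hq1 : 1 ≤ q := (Nat.le_div_iff_mul_le (by omega)).2 (by simpa using hkn)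
  have hk0 : (0 : ℝ) < k := by exact_mod_cast (show 0 < k by omega)
  have hn0 : (0 : ℝ) < n := by exact_mod_cast (show 0 < n by omega)
  -- `q ≤ n/k < q + 1`
  have hqle : (q : ℝ) ≤ (n : ℝ) / k := by
    rw [le_div_iff₀ hk0]; exact_mod_cast Nat.div_mul_le_self n k
  have hqlt : (n : ℝ) / k < q + 1 := by
    rw [div_lt_iff₀ hk0]
    have := Nat.lt_div_mul_add (a := n) (show 0 < k by omega)
    calc (n : ℝ) < (n / k * k + k : ℕ) := by exact_mod_cast this
      _ = ((q : ℝ) + 1) * k := by simp only [hq]; push_cast; ring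
  have hq1r : (1 : ℝ) ≤ q := by exact_mod_cast hq1
  have hxn : (n : ℝ) / k ≤ n := div_le_self hn0.le (by exact_mod_cast hk)
  obtain ⟨hT1, hT2⟩ := T_bounds hq1
  obtain ⟨hg1, hg2⟩ := g_sub_bounds hq1r hqle
  have hlogq : 0 ≤ Real.log q := Real.log_nonneg hq1r
  have hlogqn : Real.log q ≤ Real.log n := Real.log_le_log (by linarith) (hqle.trans hxn)
  have hlogx : Real.log ((n : ℝ) / k) ≤ Real.log n := Real.log_le_log (by positivity) hxn
  have hlogx0 : 0 ≤ Real.log ((n : ℝ) / k) := Real.log_nonneg (by linarith)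
  have hn8 : (8 : ℝ) ≤ n := by exact_mod_cast hn
  have hlogn2 : 2 ≤ Real.log n := by
    have : Real.log 8 = 3 * Real.log 2 := by
      rw [show (8 : ℝ) = 2 ^ 3 by norm_num, Real.log_pow]; norm_num
    have h8 := Real.log_le_log (by norm_num) hn8
    linarith [log_two_bounds.1]
  have hpi : 0 ≤ Real.log (2 * Real.pi) / 2 := by
    apply div_nonneg _ (by norm_num)
    exact Real.log_nonneg (by linarith [Real.two_le_pi])
  -- `T q − g(n/k) = (T q − g q) − (g(n/k) − g q)`
  have hgq : g (q : ℝ) = q * Real.log q - q := rfl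
  rw [abs_le]
  constructor
  · -- lower: `T q − g q ≥ log q/2 + log(2π)/2 ≥ 0`, `g(n/k) − g q ≤ (n/k − q) log(n/k) ≤ log n`
    have : (g ((n : ℝ) / k) - g q) ≤ 1 * Real.log n := by
      refine hg2.trans ?_
      exact mul_le_mul (by linarith) hlogx hlogx0 (by norm_num)
    linarith
  · -- upper: `T q − g q ≤ log q / 2 + 1 ≤ log n`
    linarith

/-- **`|U(n) − A n| ≤ 5 log n`** for `n ≥ 30`. [cite: Diamond1982, §3] -/
theorem abs_U_sub_le {n : ℕ} (hn : 30 ≤ n) : |U n - A * n| ≤ 5 * Real.log n := by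
  have hn0 : (0 : ℝ) < n := by exact_mod_cast (show 0 < n by omega)
  have hmain := main_term (n : ℝ) hn0
  have e1 := abs_T_sub_g_le (n := n) (k := 1) le_rfl (by omega) (by omega)
  have e2 := abs_T_sub_g_le (n := n) (k := 2) (by norm_num) (by omega) (by omega)
  have e3 := abs_T_sub_g_le (n := n) (k := 3) (by norm_num) (by omega) (by omega)
  have e5 := abs_T_sub_g_le (n := n) (k := 5) (by norm_num) (by omega) (by omega)
  have e30 := abs_T_sub_g_le (n := n) (k := 30) (by norm_num) (by omega) (by omega)
  rw [Nat.div_one] at e1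
  simp only [Nat.cast_one, div_one] at e1
  have hU : U n - A * n = (T n - g n) - (T (n / 2) - g ((n : ℝ) / 2)) - (T (n / 3) - g ((n : ℝ) / 3)) -
      (T (n / 5) - g ((n : ℝ) / 5)) + (T (n / 30) - g ((n : ℝ) / 30)) := by
    unfold U; linarith
  rw [hU]
  rw [abs_le] at e1 e2 e3 e5 e30 ⊢
  constructor <;> linarith [e1.1, e1.2, e2.1, e2.2, e3.1, e3.2, e5.1, e5.2, e30.1, e30.2]

/-- **Chebyshev's lower bound** `ψ(n) ≥ A n − 5 log n` (`n ≥ 30`). [cite: Chebyshev1852, §5] -/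
theorem psi_ge_chebyshev {n : ℕ} (hn : 30 ≤ n) : A * n - 5 * Real.log n ≤ ψ (n : ℝ) := by
  have h1 := abs_U_sub_le hn
  have h2 := U_le_psi (n := n) (by omega)
  rw [abs_le] at h1
  linarith [h1.1]

/-! ### Chebyshev's upper bound by iteration of `ψ(n) ≤ U(n) + ψ(⌊n/6⌋)` -/

/-- Small values: `ψ(n) ≤ 80` for `n ≤ 29` (from `ψ(x) ≤ x log 4 + 2√x log x`). [folklore] -/
theorem psi_le_small {n : ℕ} (hn : n ≤ 29) : ψ (n : ℝ) ≤ 80 := by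
  refine (psi_mono_nat hn).trans ?_
  have h := Chebyshev.psi_le (x := (29 : ℕ)) (by norm_num)
  push_cast at h
  have hsqrt : Real.sqrt 29 ≤ 5.4 := by
    rw [Real.sqrt_le_left (by norm_num)]; norm_num
  have hlog29 : Real.log 29 ≤ 3.466 := by
    have : Real.log 29 ≤ Real.log (2 ^ 5) := Real.log_le_log (by norm_num) (by norm_num)
    rw [Real.log_pow] at this
    push_cast at this
    linarith [log_two_bounds.2]
  have hlog4 : Real.log 4 ≤ 1.3863 := by
    rw [show (4 : ℝ) = 2 ^ 2 by norm_num, Real.log_pow]; push_cast; linarith [log_two_bounds.2]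
  have hl0 : 0 ≤ Real.log 29 := Real.log_nonneg (by norm_num)
  have hs0 : 0 ≤ Real.sqrt 29 := Real.sqrt_nonneg _
  have e1 : Real.log 4 * 29 ≤ 1.3863 * 29 := by linarith
  have e2 : 2 * Real.sqrt 29 * Real.log 29 ≤ 2 * 5.4 * 3.466 := by
    calc 2 * Real.sqrt 29 * Real.log 29 ≤ 2 * 5.4 * Real.log 29 := by gcongr
      _ ≤ 2 * 5.4 * 3.466 := by gcongr
  push_cast
  linarith

/-- `log 6 ∈ [1.791759, 1.79176]`. [folklore] -/
theorem log_six_bounds : (1.791759 : ℝ) ≤ Real.log 6 ∧ Real.log 6 ≤ 1.79176 := by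
  rw [show (6 : ℝ) = 2 * 3 by norm_num, Real.log_mul (by norm_num) (by norm_num)]
  constructor <;> linarith [log_two_bounds.1, log_two_bounds.2, KadiriNumerics.log_3_bounds.1, KadiriNumerics.log_3_bounds.2]

/-- **Chebyshev's upper bound** `ψ(n) ≤ (6A/5) n + 3 log² n + 80` for every `n`.
[cite: Chebyshev1852, §5] -/
theorem psi_le_chebyshev (n : ℕ) : ψ (n : ℝ) ≤ 6 / 5 * A * n + 3 * Real.log n ^ 2 + 80 := by
  induction n using Nat.strong_induction_on with
  | _ n ih =>
    have hA := A_bounds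
    rcases lt_or_ge n 30 with hsmall | hbig
    · have h1 := psi_le_small (n := n) (by omega)
      have h2 : 0 ≤ 6 / 5 * A * n := by have : (0 : ℝ) ≤ n := Nat.cast_nonneg _; nlinarith
      nlinarith [sq_nonneg (Real.log n)]
    · -- `ψ(n) ≤ U(n) + ψ(n/6) ≤ A n + 5 log n + ψ(n/6)`
      have hU := psi_sub_le_U (n := n) (by omega)
      have hUA := abs_U_sub_le hbig
      rw [abs_le] at hUA
      have hm : n / 6 < n := Nat.div_lt_self (by omega) (by norm_num)
      have ih6 := ih (n / 6) hm
      -- compare `n/6` (integer) with `n/6` (real) and their logs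
      have hn0 : (0 : ℝ) < n := by exact_mod_cast (show 0 < n by omega)
      have hq5 : (5 : ℝ) ≤ ((n / 6 : ℕ) : ℝ) := by
        exact_mod_cast (Nat.le_div_iff_mul_le (by norm_num)).2 (by omega)
      have hqle : ((n / 6 : ℕ) : ℝ) ≤ (n : ℝ) / 6 := Nat.cast_div_le
      have hlogq0 : 0 ≤ Real.log ((n / 6 : ℕ) : ℝ) := Real.log_nonneg (by linarith)
      have hlogq : Real.log ((n / 6 : ℕ) : ℝ) ≤ Real.log n - Real.log 6 := by
        rw [← Real.log_div hn0.ne' (by norm_num)]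
        exact Real.log_le_log (by linarith) hqle
      have hsq : Real.log ((n / 6 : ℕ) : ℝ) ^ 2 ≤ (Real.log n - Real.log 6) ^ 2 :=
        pow_le_pow_left₀ hlogq0 hlogq 2
      have hlog30 : (3.4 : ℝ) ≤ Real.log n := by
        have : Real.log 30 ≤ Real.log n := Real.log_le_log (by norm_num) (by exact_mod_cast hbig)
        have h30 : Real.log 30 = Real.log 2 + Real.log 3 + Real.log 5 := by
          rw [show (30 : ℝ) = 2 * 3 * 5 by norm_num, Real.log_mul (by norm_num) (by norm_num),
            Real.log_mul (by norm_num) (by norm_num)]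
        linarith [log_two_bounds.1, KadiriNumerics.log_3_bounds.1, KadiriNumerics.log_5_bounds.1]
      have h6 := log_six_bounds
      nlinarith [hA.1, mul_nonneg (show (0:ℝ) ≤ 6/5 * A by nlinarith [hA.1]) (sub_nonneg.2 hqle)]

/-! ### The bounds for `θ` on `[10⁶, ∞)` -/

/-- `log(10⁶) ≤ 13.8156`. [folklore] -/
theorem log_1e6_le : Real.log (10 ^ 6) ≤ (13.8156 : ℝ) := by
  rw [show ((10 : ℝ) ^ 6) = (2 * 5) ^ 6 by norm_num, Real.log_pow, Real.log_mul (by norm_num) (by norm_num)]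
  push_cast
  linarith [log_two_bounds.2, KadiriNumerics.log_5_bounds.2]

/-- For `n ≥ 10⁶` with `t = √(n/10⁶)`: `1 ≤ t`, `n = 10⁶ t²`, `log n ≤ 13.8156 + 2 t`. [folklore] -/
theorem scale_facts {n : ℕ} (hn : 10 ^ 6 ≤ n) :
    1 ≤ Real.sqrt ((n : ℝ) / 10 ^ 6) ∧ (n : ℝ) = 10 ^ 6 * Real.sqrt ((n : ℝ) / 10 ^ 6) ^ 2 ∧
      Real.log n ≤ 13.8156 + 2 * Real.sqrt ((n : ℝ) / 10 ^ 6) := by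
  have hn' : (10 ^ 6 : ℝ) ≤ n := by exact_mod_cast hn
  have hy1 : (1 : ℝ) ≤ (n : ℝ) / 10 ^ 6 := by rw [le_div_iff₀ (by norm_num)]; linarith
  set t := Real.sqrt ((n : ℝ) / 10 ^ 6)
  have ht1 : 1 ≤ t := by rw [show (1 : ℝ) = Real.sqrt 1 by simp]; exact Real.sqrt_le_sqrt hy1
  have ht2 : t ^ 2 = (n : ℝ) / 10 ^ 6 := Real.sq_sqrt (by positivity)
  refine ⟨ht1, by rw [ht2]; field_simp, ?_⟩
  have hlogy : Real.log ((n : ℝ) / 10 ^ 6) ≤ 2 * t := by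
    have : Real.log ((n : ℝ) / 10 ^ 6) = 2 * Real.log t := by
      rw [← ht2, Real.log_pow]; norm_num
    rw [this]
    have := Real.log_le_sub_one_of_pos (show 0 < t by linarith)
    linarith
  have : Real.log n = Real.log (10 ^ 6) + Real.log ((n : ℝ) / 10 ^ 6) := by
    rw [← Real.log_mul (by norm_num) (by positivity)]; congr 1; field_simp
  rw [this]
  linarith [log_1e6_le]

/-- **Upper bound** `θ(n) ≤ ψ(n) ≤ 1.107 n` for `n ≥ 10⁶`. [cite: Chebyshev1852, §5] -/
theorem psi_le_1107 {n : ℕ} (hn : 10 ^ 6 ≤ n) : ψ (n : ℝ) ≤ 1.107 * n := by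
  have h := psi_le_chebyshev n
  obtain ⟨ht1, hn_eq, hlog⟩ := scale_facts hn
  set t := Real.sqrt ((n : ℝ) / 10 ^ 6)
  have hA := A_bounds
  have hlog0 : 0 ≤ Real.log n := Real.log_natCast_nonneg n
  -- `3 log² n + 80 ≤ 831 t² = 0.000831 n`
  have h1 : Real.log n ^ 2 ≤ (13.8156 + 2 * t) ^ 2 := pow_le_pow_left₀ hlog0 hlog 2
  have h2 : (13.8156 + 2 * t) ^ 2 ≤ 250.3 * t ^ 2 := by nlinarith
  have h3 : 3 * Real.log n ^ 2 + 80 ≤ 831 * t ^ 2 := by nlinarith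
  have h4 : 831 * t ^ 2 = 0.000831 * n := by rw [hn_eq]; ring
  have h5 : A * n ≤ 0.921293 * n := mul_le_mul_of_nonneg_right hA.2 (Nat.cast_nonneg _)
  nlinarith [h, h3, h4, h5]

/-- `θ(n) ≤ 1.107 n` for `n ≥ 10⁶`. [cite: Chebyshev1852, §5] -/
theorem theta_le_1107 {n : ℕ} (hn : 10 ^ 6 ≤ n) : θ (n : ℝ) ≤ 1.107 * n :=
  (Chebyshev.theta_le_psi _).trans (psi_le_1107 hn)

/-- `ψ(x) − θ(x) ≤ log 4 · (√x + (log x/log 2) · x^{1/3})` for `x ≥ 2`. [folklore] -/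
theorem psi_sub_theta_le_sharp {x : ℝ} (hx : 2 ≤ x) :
    ψ x - θ x ≤ Real.log 4 * (Real.sqrt x + Real.log x / Real.log 2 * x ^ ((1 : ℝ) / 3)) := by
  rw [Chebyshev.psi_eq_theta_add_sum_theta hx, add_sub_cancel_left]
  set K := ⌊Real.log x / Real.log 2⌋₊
  have hx1 : 1 ≤ x := by linarith
  have hl2 : 0 < Real.log 2 := Real.log_pos (by norm_num)
  have hK : (K : ℝ) ≤ Real.log x / Real.log 2 := Nat.floor_le (div_nonneg (Real.log_nonneg hx1) hl2.le)
  have hlog4 : 0 ≤ Real.log 4 := Real.log_nonneg (by norm_num)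
  -- each term
  have hterm : ∀ k ∈ Icc 2 K, θ (x ^ ((1 : ℝ) / k)) ≤ Real.log 4 * x ^ ((1 : ℝ) / k) := fun k _ ↦
    Chebyshev.theta_le_log4_mul_x (Real.rpow_nonneg (by linarith) _)
  refine (Finset.sum_le_sum hterm).trans ?_
  rw [← Finset.mul_sum]
  refine mul_le_mul_of_nonneg_left ?_ hlog4
  rcases lt_or_ge K 2 with hK2 | hK2
  · rw [Finset.Icc_eq_empty (by omega), Finset.sum_empty]
    have h1 : 0 ≤ Real.sqrt x := Real.sqrt_nonneg _
    have h2 : 0 ≤ Real.log x / Real.log 2 * x ^ ((1 : ℝ) / 3) :=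
      mul_nonneg (div_nonneg (Real.log_nonneg hx1) hl2.le) (Real.rpow_nonneg (by linarith) _)
    linarith
  · rw [← Finset.add_sum_Ioc_eq_sum_Icc hK2]
    have hsq : x ^ ((1 : ℝ) / (2 : ℕ)) = Real.sqrt x := by
      rw [Real.sqrt_eq_rpow]; norm_num
    rw [hsq]
    gcongr
    -- the `k ≥ 3` terms
    have hk3 : ∀ k ∈ Ioc 2 K, x ^ ((1 : ℝ) / k) ≤ x ^ ((1 : ℝ) / 3) := fun k hk ↦ by
      rw [Finset.mem_Ioc] at hk
      refine Real.rpow_le_rpow_of_exponent_le hx1 ?_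
      have : (3 : ℝ) ≤ k := by exact_mod_cast hk.1
      exact one_div_le_one_div_of_le (by norm_num) this
    refine (Finset.sum_le_sum hk3).trans ?_
    rw [Finset.sum_const, Nat.card_Ioc, nsmul_eq_mul]
    refine mul_le_mul_of_nonneg_right ?_ (Real.rpow_nonneg (by linarith) _)
    have : ((K - 2 : ℕ) : ℝ) ≤ K := by exact_mod_cast Nat.sub_le K 2
    linarith

/-- **Lower bound** `θ(n) ≥ 0.9166 n` for `n ≥ 10⁶`. [cite: Chebyshev1852, §5] -/
theorem theta_ge_9166 {n : ℕ} (hn : 10 ^ 6 ≤ n) : 0.9166 * (n : ℝ) ≤ θ (n : ℝ) := by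
  have hψ := psi_ge_chebyshev (n := n) (by omega)
  have hn2 : (2 : ℝ) ≤ n := by exact_mod_cast (show 2 ≤ n by omega)
  have hd := psi_sub_theta_le_sharp hn2
  obtain ⟨ht1, hn_eq, hlog⟩ := scale_facts hn
  set t := Real.sqrt ((n : ℝ) / 10 ^ 6)
  have hA := A_bounds
  have hn0 : (0 : ℝ) < n := by positivity
  -- `√n = 1000 t`, `n^{1/3} ≤ √n / 10`
  have hsqrt : Real.sqrt n = 1000 * t := by
    rw [hn_eq, Real.sqrt_mul (by norm_num), Real.sqrt_sq (by linarith),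
      show ((10 : ℝ) ^ 6) = 1000 ^ 2 by norm_num, Real.sqrt_sq (by norm_num)]
  have hcube : (n : ℝ) ^ ((1 : ℝ) / 3) ≤ Real.sqrt n / 10 := by
    -- `n^{1/3} · 10 ≤ n^{1/2}` iff `10 ≤ n^{1/6}` iff `10⁶ ≤ n`
    rw [le_div_iff₀ (by norm_num), Real.sqrt_eq_rpow]
    have h16 : (10 : ℝ) ≤ (n : ℝ) ^ ((1 : ℝ) / 6) := by
      have : (10 : ℝ) = ((10 : ℝ) ^ (6 : ℕ)) ^ ((1 : ℝ) / 6) := by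
        rw [← Real.rpow_natCast, ← Real.rpow_mul (by norm_num)]; norm_num
      rw [this]
      exact Real.rpow_le_rpow (by norm_num) (by exact_mod_cast hn) (by norm_num)
    calc (n : ℝ) ^ ((1 : ℝ) / 3) * 10 ≤ (n : ℝ) ^ ((1 : ℝ) / 3) * (n : ℝ) ^ ((1 : ℝ) / 6) := by
          gcongr
      _ = (n : ℝ) ^ ((1 : ℝ) / 2) := by rw [← Real.rpow_add hn0]; norm_num
  have hl2 : Real.log 4 / Real.log 2 = 2 := by
    rw [show (4 : ℝ) = 2 ^ 2 by norm_num, Real.log_pow]; push_cast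
    field_simp [(Real.log_pos (by norm_num : (1 : ℝ) < 2)).ne']
  have hlog2 : 0.69314718 ≤ Real.log 2 := log_two_bounds.1
  have hlog4 : Real.log 4 ≤ 1.3862944 := by
    rw [show (4 : ℝ) = 2 ^ 2 by norm_num, Real.log_pow]; push_cast; linarith [log_two_bounds.2]
  have hlog0 : 0 ≤ Real.log n := Real.log_natCast_nonneg n
  -- assemble: `ψ − θ ≤ 1.3863(1000 t + (log n / log 2)(100 t))`, `log n ≤ 15.82 t`
  have hlogt : Real.log n ≤ 15.8156 * t := by linarith
  have hdiff : ψ (n : ℝ) - θ (n : ℝ) ≤ 1386.3 * t + 3163.3 * (t * t) := by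
    refine hd.trans ?_
    have hc : (n : ℝ) ^ ((1 : ℝ) / 3) ≤ 100 * t := by rw [hsqrt] at hcube; linarith
    have hq : Real.log n / Real.log 2 ≤ 15.8156 * t / 0.69314718 :=
      div_le_div₀ (by positivity) hlogt (by norm_num) hlog2
    have hq0 : 0 ≤ Real.log n / Real.log 2 := by positivity
    have ht0 : 0 ≤ t := by linarith
    have hq' : Real.log n / Real.log 2 ≤ 22.8172 * t := by
      refine hq.trans ?_
      rw [div_le_iff₀ (by norm_num)]
      nlinarith [ht0]
    have hprod : Real.log n / Real.log 2 * (n : ℝ) ^ ((1 : ℝ) / 3) ≤ (22.8172 * t) * (100 * t) :=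
      mul_le_mul hq' hc (Real.rpow_nonneg hn0.le _) (by positivity)
    have hsum : Real.sqrt n + Real.log n / Real.log 2 * (n : ℝ) ^ ((1 : ℝ) / 3) ≤
        1000 * t + (22.8172 * t) * (100 * t) := by rw [hsqrt]; linarith
    have hsum0 : 0 ≤ Real.sqrt n + Real.log n / Real.log 2 * (n : ℝ) ^ ((1 : ℝ) / 3) := by
      rw [hsqrt]; positivity
    calc Real.log 4 * (Real.sqrt n + Real.log n / Real.log 2 * (n : ℝ) ^ ((1 : ℝ) / 3))
        ≤ 1.3862944 * (1000 * t + (22.8172 * t) * (100 * t)) :=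
          mul_le_mul hlog4 hsum hsum0 (by norm_num)
      _ ≤ 1386.3 * t + 3163.3 * (t * t) := by nlinarith [ht0, mul_nonneg ht0 ht0]
  have e1 : 0.921292 * (n : ℝ) ≤ A * n := mul_le_mul_of_nonneg_right hA.1 (Nat.cast_nonneg _)
  have e2 : t ≤ t * t := by nlinarith
  have e3 : t * t = (n : ℝ) / 10 ^ 6 := by rw [hn_eq]; ring
  have e4 : (n : ℝ) / 10 ^ 6 = 0.000001 * n := by ring
  linarith [e1, e2, e3, e4, hψ, hdiff, hlogt]

/-- **The envelope for `TuranPartialSums`**: for every integer `n ≥ 10⁶`,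
`0.9166 n ≤ θ(n) ≤ 1.107 n`. [cite: Chebyshev1852, §5] -/
theorem theta_bounds_1e6 {n : ℕ} (hn : 10 ^ 6 ≤ n) :
    0.9166 * (n : ℝ) ≤ θ (n : ℝ) ∧ θ (n : ℝ) ≤ 1.107 * n :=
  ⟨theta_ge_9166 hn, theta_le_1107 hn⟩

end Literature.NumberTheory.LFunctions.ChebyshevExplicit
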